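import Summits.BirchSwinnertonDyer.Rank1Residual.GaloisImage.KolyvaginTransverseClasses
import Summits.BirchSwinnertonDyer.Rank1Residual.GaloisImage.KolyvaginTransverseCocycle
import Summits.BirchSwinnertonDyer.Rank1Residual.GaloisImage.KolyvaginTransferCocycle

/-!
# THEOREM D-tr of T-DER (generic form for the tree's `IsEulerSystem`): the Kolyvagin derivative
# class minus a coboundary vanishes at the Frobenius and on the inertia of the primes of its level —
# file 3b of row T-DER-TR (assembly of files 1–3;
# cell `b2b-bsdres`, team n1011, seat p15 GEN 8, OWNERS row T-DER-TR = skel/T-DER-TR.md)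

HONEST FRAMING (cell `b2b-bsdres`, run/shared/lean/b2b/bsd-rank1-residual/, verbatim in every
file): the goal of the cell is to DELETE the COMBINATION-SHAPED residual classes of the
Birch–Swinnerton-Dyer formula for ALL analytic-rank `≤ 1` elliptic curves over `ℚ` — "full BSD
formula for every rank `≤ 1` curve in class `C`" assembled STRICTLY from published theorems — so
that the rank-`≤ 1` remainder becomes exactly the CONSTRUCTION-SHAPED classes, which are TYPED
(missing-input `Prop`s), NOT attempted. This is not "finishing BSD". Team n1011: research route on
the CONSTRUCTION-SHAPED class X4 / §I N11 (route-1 PORT, (P-DER)); TOOL theorems of continuous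
group cohomology (no definition, no named fact, no `sorry`); curve-free, `p`-free.

## What ([MR04] App. A, Thm. A.4 ⇒ `(κ_n)_{q,f} = 0` in the `(X−1)²` case, for the tree's
## `IsEulerSystem` and THEOREM A's derivative classes)

* `map_noncommProd_deriv_apply` — transport of the derivative operator `D_n` along an intertwining
  linear map (coefficient change `red_*`);
* `red_noncommProd_deriv_modified_eq` — the MODIFIED `T`-level derivative class reduces to the
  derivative class: `red_* (D_n x″_n) = D_n (red_* c_{⊥,n})` in `H¹(U_n, T')` when `½N_q(N_q−1)`
  (`= Σ_{i<N_q} i`) kills `T'` (`p` odd in the application): `D_q (𝐙 x_{n∖q}) = (Σ i) • 𝐙 x_{n∖q}`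
  because `σ_q` fixes `x_{n∖q}`;
* `eq_rho_sub_sub_smul_of_value` — **(β′)**, the `T`-level evaluation of file 2 at ONE marked
  element `g₀ ∈ U_n` (a Frobenius power at the prime of `Fr`): `e = Fr t − t − I • s` from
  `Fr·Ψ(Fr⁻¹uFr) − Ψ(u) = I • z(u) + ∂e(u)`, `Ψ(g₀) = ∂t(g₀)`, `z(g₀) = ∂s(g₀)`, `T^{g₀} = 0`;
* `exists_apply_eq_rho_sub_of_deriv` — **THEOREM D-tr (values form)**: for every representative
  `Φ` of every class `κ ∈ H¹(K, T')` with `res_{U_n} κ = D_n (red_* c_{⊥,n})` (THEOREM A3's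
  characterisation of the derivative class `κ_n`, F4 `existsUnique_res_eq_deriv`), there is ONE
  `t₁ ∈ T'` with `Φ(Frq) = Frq t₁ − t₁` for the arithmetic Frobenius `Frq ∈ tameLevel q` and
  `Φ(u) = u t₁ − t₁` on the inertia at `q` inside `U_n`: `Φ − ∂t₁` vanishes at the Frobenius and on
  the inertia — the input of the local criterion (`FSComp.cocycle_eq_zero_of_apply_frob_eq_zero`,
  `mem_transverseSubgroup_cyclotomicField_iff`) by which file 4 concludes
  `loc_q κ_n ∈ cyclotomicTransverse` over `ℚ`.  All arithmetic inputs are DISPLAYED as in file 3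
  (`hIN`, `hPℓ`, `hPq`, `hvan`) plus `hI : I • T' = 0`, `hodd : (Σ_{i<N_q} i) • T' = 0`, `h0`, the
  inertia binders `hIqT hIqT' hIvan` (E1), `h0loc` (Weil, CK-2), `hFrqg₀` (same decomposition group).
Proof: file 3 gives the coboundary values of `D_n x″_n` and of `s` with
`conj(Frq) D_n x″_n − D_n x″_n = I • s`; choose cocycles (G1
`exists_forall_apply_eq_add_of_oneCocycleClass_eq`); (β′); file 2's (α) `apply_eq_of_smul_witness`.
The augmentation hypothesis `hG` of file 1 (`conj(Frq)` is a word in the `σ_j`, `j ≠ q`) is not a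
binder here: it is DERIVED inside file 3 `sub_conjMap_noncommProd_deriv_mem_smul_localVanishing`
from `hFrq : Frq ∈ L.tameLevel q` by T-DER F3a `exists_mem_closure_inv_mul_mem` (`hσ`, `hcov`) and
file 3a `Transverse.conjMap_mem_closure_of_inv_mul_mem`.

References: B. Mazur, K. Rubin, *Kolyvagin systems*, Mem. AMS 799 (2004), App. A pp. 79–87;
K. Rubin, *Euler Systems* (2000), §4.4–§4.8.
-/

noncomputable section

open CategoryTheory Function Finset Polynomial Field IsDedekindDomain
open scoped NumberField Classical
open Literature.NumberTheory.GaloisRepresentations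
open Literature.NumberTheory.EllipticCurves (subgroupInclusion subgroupConj subgroupConj_apply_coe)

universe u v w

namespace Summit.BirchSwinnertonDyer.Rank1Residual.GaloisImage

namespace Derivative

namespace Transverse

/-! ### §1 Transport of `D_n` along an intertwining linear map -/

section Transport

variable {A : Type u} [CommRing A] {X : Type v} {Y : Type w} [AddCommGroup X] [Module A X]
  [AddCommGroup Y] [Module A Y] {ι : Type*}

/-- If `f ∘ E_ℓ = E'_ℓ ∘ f` for all `ℓ ∈ s` then `f (D_s y) = D'_s (f y)` for the derivative products
`D_s = s.noncommProd (Σ_{j<N_ℓ} j E_ℓ^j)` (F1 `apply_deriv_apply_eq_of_comm` factor by factor).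
[folklore] -/
theorem map_noncommProd_deriv_apply (f : X →ₗ[A] Y) (E : ι → Module.End A X) (E' : ι → Module.End A Y)
    (N : ι → ℕ) (s : Finset ι) (comm) (comm') (h : ∀ ℓ ∈ s, ∀ v, f (E ℓ v) = E' ℓ (f v)) (y : X) :
    f ((s.noncommProd (fun ℓ => ∑ j ∈ range (N ℓ), (j : Module.End A X) * E ℓ ^ j) comm) y) =
      (s.noncommProd (fun ℓ => ∑ j ∈ range (N ℓ), (j : Module.End A Y) * E' ℓ ^ j) comm') (f y) := by
  classical
  induction s using Finset.induction_on generalizing y with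
  | empty => simp
  | insert a s ha ih =>
    rw [Finset.noncommProd_insert_of_notMem _ _ _ _ ha, Finset.noncommProd_insert_of_notMem _ _ _ _ ha,
      Module.End.mul_apply, Module.End.mul_apply,
      apply_deriv_apply_eq_of_comm f (h a (Finset.mem_insert_self a s)) (N a)]
    congr 1
    exact ih _ _ (fun ℓ hℓ v => h ℓ (Finset.mem_insert_of_mem hℓ) v) y

end Transport

/-! ### §2 The modified derivative class reduces to the derivative class -/

section Reduction

variable {K : Type u} [Field K] [NumberField K] {ι : Type w} [Preorder ι] [OrderBot ι]
variable {A : Type v} [CommRing A] [TopologicalSpace A]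
variable {M : Type u} [AddCommGroup M] [Module A M] [TopologicalSpace M] [IsTopologicalAddGroup M]
  [ContinuousSMul A M]
variable {L : EulerSystemLevels K ι} {T : GaloisRep K A M}
variable {M' : Type u} [AddCommGroup M'] [Module A M'] [TopologicalSpace M'] [IsTopologicalAddGroup M']
  [ContinuousSMul A M'] {T' : GaloisRep K A M'}

/-- **`red_* (D_n x″_n) = D_n (red_* x_n)`.**  On `H¹(U, T)` let `E_ℓ = conj(σ_ℓ)` and `Z` an operator
commuting with `E_q` (`= E_q(Fr_q⁻¹)`), `x, w ∈ H¹(U, T)` with `E_q w = w` (`x = c_{⊥,n}`,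
`w = res c_{⊥,n∖q}`); if `(Σ_{i<N_q} i) • H¹(U, T') = 0` then
`red_* (D_n (x − Z w)) = D_n (red_* x)` — the correction `D_n (Z w) = (Σ i) • D_{n∖q} Z w` dies under
`red_*`.  (The `p`-odd step of (S1): `D_q x_{n∖q} = ½N_q(N_q−1) x_{n∖q}`.) [folklore] -/
theorem red_noncommProd_deriv_modified_eq (red : T.toTopRep ⟶ T'.toTopRep)
    (U : Subgroup (absoluteGaloisGroup K)) [U.Normal] (i : ι) (n : Finset (HeightOneSpectrum (𝓞 K)))
    (hU : U = L.level i n)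
    (σ : HeightOneSpectrum (𝓞 K) → absoluteGaloisGroup K) (N : HeightOneSpectrum (𝓞 K) → ℕ) (comm) (comm')
    {q : HeightOneSpectrum (𝓞 K)} (hq : q ∈ n) (Z : Module.End A (H1 T U))
    (hZ : Commute Z (conjMap T.toTopRep U (σ q) 1).hom.toLinearMap)
    (hZ' : ∀ ℓ ∈ n, Commute Z (conjMap T.toTopRep U (σ ℓ) 1).hom.toLinearMap)
    (x w : H1 T U) (hw : conjMap T.toTopRep U (σ q) 1 w = w)
    (hodd : ∀ y : continuousCohomology 1 (subgroupRep T'.toTopRep U),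
      ((∑ j ∈ range (N q), j : ℕ) : A) • y = 0) :
    ContinuousCohomology.map (ContinuousMonoidHom.id _) (X := subgroupRep T.toTopRep U)
        (Y := subgroupRep T'.toTopRep U) ((TopRep.resFunctor U.subtype).map red) 1
        ((n.noncommProd (fun ℓ => ∑ j ∈ range (N ℓ), (j : Module.End A (H1 T U)) *
          (conjMap T.toTopRep U (σ ℓ) 1).hom.toLinearMap ^ j) comm) (x - Z w)) =
      (n.noncommProd (fun ℓ => ∑ j ∈ range (N ℓ), (j : Module.End A (continuousCohomology 1
          (subgroupRep T'.toTopRep U))) * (conjMap T'.toTopRep U (σ ℓ) 1).hom.toLinearMap ^ j) comm')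
        (ContinuousCohomology.map (ContinuousMonoidHom.id _) (X := subgroupRep T.toTopRep U)
          (Y := subgroupRep T'.toTopRep U) ((TopRep.resFunctor U.subtype).map red) 1 x) := by
  subst hU
  let X₁ := H1 T (L.level i n)
  let X₂ := continuousCohomology 1 (subgroupRep T'.toTopRep (L.level i n))
  let E : HeightOneSpectrum (𝓞 K) → Module.End A X₁ :=
    fun ℓ => (conjMap T.toTopRep (L.level i n) (σ ℓ) 1).hom.toLinearMap
  let E' : HeightOneSpectrum (𝓞 K) → Module.End A X₂ :=
    fun ℓ => (conjMap T'.toTopRep (L.level i n) (σ ℓ) 1).hom.toLinearMap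
  let Df : HeightOneSpectrum (𝓞 K) → Module.End A X₁ :=
    fun ℓ => ∑ j ∈ range (N ℓ), (j : Module.End A X₁) * E ℓ ^ j
  let Df' : HeightOneSpectrum (𝓞 K) → Module.End A X₂ :=
    fun ℓ => ∑ j ∈ range (N ℓ), (j : Module.End A X₂) * E' ℓ ^ j
  let redU : X₁ →ₗ[A] X₂ :=
    (ContinuousCohomology.map (ContinuousMonoidHom.id _) (X := subgroupRep T.toTopRep (L.level i n))
      (Y := subgroupRep T'.toTopRep (L.level i n)) ((TopRep.resFunctor (L.level i n).subtype).map red)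
      1).hom.toLinearMap
  have hEE : ∀ a b, Commute (E a) (E b) := fun a b => commute_conjMap_hom_level i n (σ a) (σ b)
  have comm₁ : (n : Set (HeightOneSpectrum (𝓞 K))).Pairwise fun a b => Commute (Df a) (Df b) :=
    fun a _ b _ _ => commute_deriv_deriv hEE N a b
  change redU (n.noncommProd Df comm₁ (x - Z w)) = n.noncommProd Df' comm' (redU x)
  have hred : ∀ ℓ ∈ n, ∀ v, redU (E ℓ v) = E' ℓ (redU v) := fun ℓ _ v => red_conjMap red (σ ℓ) v
  rw [map_sub (n.noncommProd Df comm₁), map_sub redU,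
    map_noncommProd_deriv_apply redU E E' N n comm₁ comm' hred x, sub_eq_self]
  -- the correction term vanishes: `D_n = D_q * D_{n∖q}`
  have comm₂ : ((n.erase q : Finset _) : Set (HeightOneSpectrum (𝓞 K))).Pairwise
      fun a b => Commute (Df a) (Df b) := fun a _ b _ _ => commute_deriv_deriv hEE N a b
  have hsplit : n.noncommProd Df comm₁ = Df q * (n.erase q).noncommProd Df comm₂ := by
    have h := Finset.noncommProd_insert_of_notMem (n.erase q) q Df
      (fun a _ b _ _ => commute_deriv_deriv hEE N a b) (Finset.notMem_erase q n)
    rw [← h]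
    exact Finset.noncommProd_congr (Finset.insert_erase hq).symm (fun _ _ => rfl) _
  -- `E_q` fixes `v := D_{n∖q} (Z w)`
  have hEqv : E q ((n.erase q).noncommProd Df comm₂ (Z w)) = (n.erase q).noncommProd Df comm₂ (Z w) := by
    have hc : Commute (E q) ((n.erase q).noncommProd Df comm₂) :=
      Finset.noncommProd_commute _ _ _ _ fun b _ => commute_deriv_of_commute (hEE q b) (N b)
    rw [apply_comm_of_commute hc, apply_comm_of_commute hZ.symm]
    exact congrArg _ (congrArg _ hw)
  have hDq : Df q ((n.erase q).noncommProd Df comm₂ (Z w)) =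
      ((∑ j ∈ range (N q), j : ℕ) : A) • (n.erase q).noncommProd Df comm₂ (Z w) := by
    have hpow : ∀ j : ℕ, (E q ^ j) ((n.erase q).noncommProd Df comm₂ (Z w)) =
        (n.erase q).noncommProd Df comm₂ (Z w) := fun j => by
      induction j with
      | zero => rfl
      | succ j ih => rw [pow_succ, Module.End.mul_apply, hEqv, ih]
    change (∑ j ∈ range (N q), (j : Module.End A X₁) * E q ^ j) _ = _
    rw [LinearMap.sum_apply, Nat.cast_sum, Finset.sum_smul]
    refine Finset.sum_congr rfl fun j _ => ?_
    rw [Module.End.mul_apply, hpow j, Module.End.natCast_apply, Nat.cast_smul_eq_nsmul]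
  rw [hsplit, Module.End.mul_apply, hDq, map_smul, hodd]

end Reduction

/-! ### §3 (β′) The `T`-level evaluation at a single marked element -/

section BetaPrime

variable {R : Type v} [CommRing R] [TopologicalSpace R]
variable {G : Type u} [Group G] [TopologicalSpace G] [IsTopologicalGroup G]
variable (X : TopRep.{u} R G) (N : Subgroup G) [N.Normal]

/-- **(β′) The `T`-level evaluation at ONE marked element.**  Let `Fr ∈ G` and `g₀ ∈ N` be such
that `Fr⁻¹ g₀ Fr = g₀ · j` with the `N`-cocycle `Ψ` vanishing at `j` and `X.ρ j = 1` (in the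
application `j` is an inertia element at the prime of `Fr`: `Fr` and `g₀` lie in the same
decomposition group), and suppose `Fr·Ψ(Fr⁻¹uFr) − Ψ(u) = M • z(u) + (u e − e)` on `N`,
`Ψ(g₀) = g₀ t − t`, `z(g₀) = g₀ s − s` and `X^{g₀} = 0` (`ρ(g₀) − 1` injective: Weil).  Then
`e = Fr t − t − M • s`. [folklore] -/
theorem eq_rho_sub_sub_smul_of_value (Ψ z : contOneCocycles (subgroupRep X N)) (Fr : G) (g₀ : N)
    (j : N) (hj : (subgroupConj N Fr g₀ : N) = g₀ * j) (hjρ : ∀ x : X, X.ρ (j : G) x = x)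
    (hΨj : Ψ.1 j = 0) (M : R) (e t s : X)
    (hW : ∀ u : N, X.ρ Fr (Ψ.1 (subgroupConj N Fr u)) - Ψ.1 u = M • z.1 u + (X.ρ (u : G) e - e))
    (ht : Ψ.1 g₀ = X.ρ (g₀ : G) t - t) (hs : z.1 g₀ = X.ρ (g₀ : G) s - s)
    (h0 : ∀ x : X, X.ρ (g₀ : G) x = x → x = 0) :
    e = X.ρ Fr t - t - M • s := by
  -- `ρ(Fr)` and `ρ(g₀)` commute (their commutator is `ρ(j) = 1`)
  have hcomm : ∀ x : X, X.ρ Fr (X.ρ (g₀ : G) x) = X.ρ (g₀ : G) (X.ρ Fr x) := by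
    intro x
    have hj' : ((g₀ : N) : G) * (j : G) = Fr⁻¹ * (g₀ : G) * Fr := by
      have := congrArg (fun u : N => (u : G)) hj
      simp only [subgroupConj_apply_coe, Subgroup.coe_mul] at this
      exact this.symm
    have h1 : X.ρ (Fr⁻¹ * (g₀ : G) * Fr) x = X.ρ (g₀ : G) x := by
      rw [← hj', ρ_mul_apply, hjρ]
    have h2 := congrArg (X.ρ Fr) h1
    rw [ρ_mul_apply, ρ_mul_apply, ρ_apply_ρ_inv_apply] at h2
    -- `h2 : ρ g₀ (ρ Fr x) = ρ Fr (ρ g₀ x)`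
    exact h2.symm
  have h := hW g₀
  rw [hj, Ψ.2 g₀ j, hΨj, map_zero, add_zero, ht, hs, map_sub, hcomm, smul_sub] at h
  -- `h : g₀ (Fr t) − Fr t − (g₀ t − t) = M • g₀ s − M • s + (g₀ e − e)`
  have hfix : X.ρ (g₀ : G) (X.ρ Fr t - t - M • s - e) = X.ρ Fr t - t - M • s - e := by
    rw [← sub_eq_zero] at h ⊢
    rw [← h]
    simp only [map_sub, map_smul]
    abel
  have hzero := h0 _ hfix
  rw [sub_eq_zero] at hzero
  exact hzero.symm

end BetaPrime

/-! ### §4 THEOREM D-tr for the tree's `IsEulerSystem`: the values of the derivative class at the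
Frobenius and on the inertia of `q` -/

section Main

variable {K : Type u} [Field K] [NumberField K] {ι : Type w} [Preorder ι] [OrderBot ι]
variable {A : Type v} [CommRing A] [TopologicalSpace A]
variable {M : Type u} [AddCommGroup M] [Module A M] [TopologicalSpace M] [IsTopologicalAddGroup M]
  [ContinuousSMul A M] [Module.Free A M] [Module.Finite A M]
variable {L : EulerSystemLevels K ι} {T : GaloisRep K A M} {p : ℕ} [Fact p.Prime] [Algebra ℤ_[p] A]
variable {c : ∀ (i : ι) (r : L.Ideals), H1 T (L.level i r.1)}
variable {M' : Type u} [AddCommGroup M'] [Module A M'] [TopologicalSpace M'] [IsTopologicalAddGroup M']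
  [ContinuousSMul A M'] {T' : GaloisRep K A M'}

-- The statement carries the full displayed binder lists of files 1–3; elaborating the final
-- assembly against them needs about twice the default budget (no `decide`, no search).
set_option maxHeartbeats 400000 in
/-- **THEOREM D-tr for the tree's `IsEulerSystem` (the values of the derivative class `κ_n` at an
arithmetic Frobenius of `q ∈ n` and on the inertia at `q`)** — [MR04] App. A Thm. A.4 ⇒
`(κ_n)_{q,f} = 0` in the case where every Euler factor is `≡ (X−1)²` modulo the modulus `I` of the
coefficients `T' = T/I`.  Data/hypotheses: those of file 3
`sub_conjMap_noncommProd_deriv_mem_smul_localVanishing` (Euler system `c`, level `n`, THEOREM A's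
`σ N Fr hσ hcov hinj hFr hram`, `q ∈ n`, `I`, `E_q`, the Kolyvagin congruences `hIN hPℓ hPq`, the
conjugation-invariant marked set `𝒢 ⊆ U_n` with the semi-local congruence `hvan`); the reduction
`red : T → T'` with `I • T' = 0` and `(Σ_{i<N_q} i) • T' = 0` (`p` odd), `T'^{U_n} = 0` (`h0`, as
F4); an inertia subgroup `Iq` at `q` acting trivially on `T` and `T'` on which every `T`-valued
cocycle of `U_n` vanishes (`hIvan`: E1 `apply_eq_zero_of_mem_inertia_of_mem_tate`); a marked element
`g₀ ∈ 𝒢` with `T^{g₀} = 0` (`h0loc`: Weil, CK-2) and an element `Frq ∈ tameLevel q` (the arithmetic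
Frobenius at `q` FIXING `K(q)`, CK-1a) with `Frq⁻¹ g₀ Frq g₀⁻¹`-commutator in `Iq` (same decomposition
group).  Conclusion: every representative `Φ` of every class `κ` with
`res_{U_n} κ = D_n (red_* c_{⊥,n})` (THEOREM A3's characterisation of `κ_n`) satisfies, for ONE
`t₁ ∈ T'`, `Φ(Frq) = Frq·t₁ − t₁` and `Φ(u) = u·t₁ − t₁` for every `u ∈ U_n ∩ Iq` — i.e. `Φ − ∂t₁`
VANISHES at the Frobenius and on the inertia of `q` inside `U_n`: the input of the local criterion
(`FSComp.cocycle_eq_zero_of_apply_frob_eq_zero` / `mem_transverseSubgroup_cyclotomicField_iff`) by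
which file 4 concludes `loc_q κ_n ∈ cyclotomicTransverse` over `ℚ`.
[cite: MazurRubin2004, App. A, Thm. A.4 (p. 80)] -/
theorem exists_apply_eq_rho_sub_of_deriv (hc : IsEulerSystem L T p c)
    (red : T.toTopRep ⟶ T'.toTopRep) (n : L.Ideals)
    (σ : HeightOneSpectrum (𝓞 K) → absoluteGaloisGroup K) (N : HeightOneSpectrum (𝓞 K) → ℕ)
    (Fr : HeightOneSpectrum (𝓞 K) → absoluteGaloisGroup K)
    (hσ : ∀ ℓ ∈ n.1, ∀ q ∈ n.1, q ≠ ℓ → σ ℓ ∈ L.tameLevel q)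
    (hcov : ∀ ℓ ∈ n.1, ∀ g : absoluteGaloisGroup K, ∃ j < N ℓ, (σ ℓ ^ j)⁻¹ * g ∈ L.tameLevel ℓ)
    (hinj : ∀ ℓ ∈ n.1, ∀ j₁ < N ℓ, ∀ j₂ < N ℓ, (σ ℓ ^ j₁)⁻¹ * σ ℓ ^ j₂ ∈ L.tameLevel ℓ → j₁ = j₂)
    (hN1 : ∀ ℓ ∈ n.1, 1 ≤ N ℓ)
    (hFr : ∀ ℓ ∈ n.1, IsArithFrobAtPlace K ℓ (Fr ℓ))
    (hram : ∀ ℓ ∈ n.1, ∀ s ⊆ n.1, ℓ ∉ s → ¬ SubgroupIsUnramifiedAt K (L.level ⊥ (insert ℓ s)) ℓ)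
    (comm') {q : HeightOneSpectrum (𝓞 K)} (hq : q ∈ n.1) (Eq : A[X]) (I : A)
    (hIN : ∀ ℓ ∈ n.1, ∃ a : A, (N ℓ : A) = I * a)
    (hPℓ : ∀ ℓ ∈ n.1, ℓ ≠ q → ∃ R : A[X],
      rubinEulerFactor T.toRepresentation (cyclotomicCharacterToUnits K p A) (Fr ℓ) =
        (Polynomial.X - C 1) ^ 2 + C I * R)
    (hPq : ∃ R : A[X],
      rubinEulerFactor T.toRepresentation (cyclotomicCharacterToUnits K p A) (Fr q) - C (N q : A) * Eq =
        (Polynomial.X - C 1) ^ 2 + C I * R)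
    (𝒢 : Set (absoluteGaloisGroup K)) (h𝒢U : ∀ g ∈ 𝒢, g ∈ L.level ⊥ n.1)
    (h𝒢 : ∀ g ∈ 𝒢, ∀ h : absoluteGaloisGroup K, h⁻¹ * g * h ∈ 𝒢)
    (hvan : ∀ (m : L.Ideals) (h₁ : L.level ⊥ n.1 ≤ L.level ⊥ (m.cons q (n.2 q hq)).1)
      (h₂ : L.level ⊥ n.1 ≤ L.level ⊥ m.1), q ∉ m.1 → ∀ g (hg : g ∈ 𝒢),
      ∃ (φ : contOneCocycles (subgroupRep T.toTopRep (L.level ⊥ n.1))) (w : M),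
        oneCocycleClass _ φ = resLe T.toTopRep h₁ 1 (c ⊥ (m.cons q (n.2 q hq))) -
          aeval (frobeniusInvOp T (L.level ⊥ n.1) (Fr q)) Eq (resLe T.toTopRep h₂ 1 (c ⊥ m)) ∧
        φ.1 ⟨g, h𝒢U g hg⟩ = T.toTopRep.ρ g w - w)
    (hI : ∀ v : M', I • v = 0) (hodd : ∀ v : M', ((∑ j ∈ range (N q), j : ℕ) : A) • v = 0)
    (h0 : ∀ v : T'.toTopRep, (∀ u : L.level ⊥ n.1, T'.toTopRep.ρ (u : absoluteGaloisGroup K) v = v) →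
      v = 0)
    (Iq : Subgroup (absoluteGaloisGroup K)) (hIqT : ∀ i ∈ Iq, ∀ x : T.toTopRep, T.toTopRep.ρ i x = x)
    (hIqT' : ∀ i ∈ Iq, ∀ v : T'.toTopRep, T'.toTopRep.ρ i v = v)
    (hIvan : ∀ (ψ : contOneCocycles (subgroupRep T.toTopRep (L.level ⊥ n.1))) (u : L.level ⊥ n.1),
      (u : absoluteGaloisGroup K) ∈ Iq → ψ.1 u = 0)
    {g₀ : absoluteGaloisGroup K} (hg₀ : g₀ ∈ 𝒢)
    (h0loc : ∀ x : T.toTopRep, T.toTopRep.ρ g₀ x = x → x = 0)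
    {Frq : absoluteGaloisGroup K} (hFrq : Frq ∈ L.tameLevel q) (hFrqg₀ : g₀⁻¹ * (Frq⁻¹ * g₀ * Frq) ∈ Iq)
    (κ : continuousCohomology 1 T'.toTopRep)
    (hκ : resSubgroup T'.toTopRep (L.level ⊥ n.1) 1 κ =
      (n.1.noncommProd (fun ℓ => ∑ j ∈ range (N ℓ), (j : Module.End A (continuousCohomology 1
          (subgroupRep T'.toTopRep (L.level ⊥ n.1)))) *
          (conjMap T'.toTopRep (L.level ⊥ n.1) (σ ℓ) 1).hom.toLinearMap ^ j) comm')
        (ContinuousCohomology.map (ContinuousMonoidHom.id _) (X := subgroupRep T.toTopRep (L.level ⊥ n.1))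
          (Y := subgroupRep T'.toTopRep (L.level ⊥ n.1))
          ((TopRep.resFunctor (L.level ⊥ n.1).subtype).map red) 1 (c ⊥ n)))
    (Φ : contOneCocycles T'.toTopRep) (hΦκ : oneCocycleClass _ Φ = κ) :
    ∃ t₁ : M', Φ.1 Frq = T'.toTopRep.ρ Frq t₁ - t₁ ∧
      ∀ u : L.level ⊥ n.1, (u : absoluteGaloisGroup K) ∈ Iq →
        Φ.1 u = T'.toTopRep.ρ (u : absoluteGaloisGroup K) t₁ - t₁ := by
  set U : Subgroup (absoluteGaloisGroup K) := L.level ⊥ n.1 with hUdef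
  have comm : (n.1 : Set (HeightOneSpectrum (𝓞 K))).Pairwise fun a b => Commute
      (∑ j ∈ range (N a), (j : Module.End A (H1 T U)) * (conjMap T.toTopRep U (σ a) 1).hom.toLinearMap ^ j)
      (∑ j ∈ range (N b), (j : Module.End A (H1 T U)) * (conjMap T.toTopRep U (σ b) 1).hom.toLinearMap ^ j) :=
    fun a _ b _ _ => commute_deriv_deriv (fun a b => commute_conjMap_hom_level ⊥ n.1 (σ a) (σ b)) N a b
  -- file 3: the modified derivative class and its Frobenius-difference
  obtain ⟨hyS, s, hsS, hys⟩ := sub_conjMap_noncommProd_deriv_mem_smul_localVanishing hc n σ N Fr hσ hcov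
    hinj hN1 hFr hram comm hq Eq I hIN hPℓ hPq 𝒢 h𝒢U h𝒢 hvan Frq hFrq
  set Z : Module.End A (H1 T U) := aeval (frobeniusInvOp T U (Fr q)) Eq with hZdef
  set w : H1 T U := resLe T.toTopRep (level_antitone L ⊥ (Finset.erase_subset q n.1)) 1
      (c ⊥ ⟨n.1.erase q, fun ℓ hℓ => n.2 ℓ (Finset.erase_subset q n.1 hℓ)⟩) with hwdef
  set y : H1 T U := (n.1.noncommProd (fun ℓ => ∑ j ∈ range (N ℓ), (j : Module.End A (H1 T U)) *
      (conjMap T.toTopRep U (σ ℓ) 1).hom.toLinearMap ^ j) comm) (c ⊥ n - Z w) with hydef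
  -- `red_* y = D_n (red_* c_{⊥,n}) = res_U κ`
  have hZE : ∀ ℓ ∈ n.1, Commute Z (conjMap T.toTopRep U (σ ℓ) 1).hom.toLinearMap := fun ℓ _ =>
    (commute_aeval_of_commute (commute_conjMap_hom_level ⊥ n.1 (Fr q)⁻¹ (σ ℓ)).symm Eq).symm
  have hw : conjMap T.toTopRep U (σ q) 1 w = w := by
    have hσq : σ q ∈ L.level ⊥ (n.1.erase q) :=
      mem_level_of_forall L (by rw [L.pLevel_bot]; exact Subgroup.mem_top _) fun q' hq' =>
        hσ q hq q' (Finset.mem_of_mem_erase hq') (Finset.mem_erase.mp hq').1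
    rw [hwdef, ← resLe_conjMap, conjMap_eq_self_of_mem T.toTopRep hσq]
  have hred : ContinuousCohomology.map (ContinuousMonoidHom.id _) (X := subgroupRep T.toTopRep U)
      (Y := subgroupRep T'.toTopRep U) ((TopRep.resFunctor U.subtype).map red) 1 y =
      resSubgroup T'.toTopRep U 1 κ := by
    rw [hκ, hydef]
    exact red_noncommProd_deriv_modified_eq red U ⊥ n.1 rfl σ N comm comm' hq Z (hZE q hq) hZE
      (c ⊥ n) w hw (fun y' => smul_eq_zero_of_forall_smul_eq_zero T'.toTopRep _ hodd y')
  -- cocycle representatives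
  obtain ⟨Ψ, hΨ⟩ := oneCocycleClass_surjective _ y
  obtain ⟨z, hz⟩ := oneCocycleClass_surjective _ s
  -- (W) the Frobenius-difference at cocycle level
  have hcl : oneCocycleClass _ (contOneCocycles.pullback (subgroupConj U Frq) (conjRepHom T.toTopRep U Frq) Ψ) =
      oneCocycleClass _ (Ψ + I • z) := by
    rw [← conjMap_oneCocycleClass, hΨ, oneCocycleClass_add, oneCocycleClass_smul, hΨ, hz, ← hys]
    abel
  obtain ⟨e, he⟩ := Congruence.exists_forall_apply_eq_add_of_oneCocycleClass_eq T.toTopRep _ _ hcl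
  have hW : ∀ u : U, T.toTopRep.ρ Frq (Ψ.1 (subgroupConj U Frq u)) - Ψ.1 u =
      I • z.1 u + (T.toTopRep.ρ (u : absoluteGaloisGroup K) e - e) := by
    intro u
    have h := he u
    rw [conj_pullback_apply] at h
    rw [h]
    change Ψ.1 u + I • z.1 u + _ - Ψ.1 u = _
    abel
  -- (t), (s): coboundary values at `g₀`
  obtain ⟨t, ht⟩ := hyS g₀ hg₀ Ψ hΨ
  obtain ⟨s₀, hs₀⟩ := hsS g₀ hg₀ z hz
  -- (β′)
  set g₀' : U := ⟨g₀, h𝒢U g₀ hg₀⟩ with hg₀'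
  set j : U := ⟨g₀⁻¹ * (Frq⁻¹ * g₀ * Frq), by
    refine U.mul_mem (U.inv_mem (h𝒢U g₀ hg₀)) ?_
    exact Subgroup.Normal.conj_mem' inferInstance _ (h𝒢U g₀ hg₀) Frq⟩ with hjdef
  have hj : (subgroupConj U Frq g₀' : U) = g₀' * j := Subtype.ext (by
    simp only [subgroupConj_apply_coe, Subgroup.coe_mul, hg₀', hjdef, mul_inv_cancel_left])
  have he' : e = T.toTopRep.ρ Frq t - t - I • s₀ :=
    eq_rho_sub_sub_smul_of_value T.toTopRep U Ψ z Frq g₀' j hj (fun x => hIqT _ hFrqg₀ x)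
      (hIvan Ψ j hFrqg₀) I e t s₀ hW ht hs₀ h0loc
  -- `Φ|_U = red ∘ Ψ + ∂w₀`
  have hclU : oneCocycleClass _ (contOneCocycles.pullback (Literature.NumberTheory.GaloisRepresentations.subgroupSubtypeHom U)
      (Y := subgroupRep T'.toTopRep U) (TopRep.ofHom ⟨ContinuousLinearMap.id A T'.toTopRep, fun _ => rfl⟩) Φ) =
      oneCocycleClass _ (contOneCocycles.pullback (ContinuousMonoidHom.id U)
        ((TopRep.resFunctor U.subtype).map red) Ψ) := by
    rw [← resSubgroup_oneCocycleClass, ← red_oneCocycleClass, hΨ, hred, hΦκ]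
  obtain ⟨w₀, hw₀⟩ := Congruence.exists_forall_apply_eq_add_of_oneCocycleClass_eq T'.toTopRep _ _ hclU
  have hΦ : ∀ u : U, Φ.1 u = red.hom (Ψ.1 u) + (T'.toTopRep.ρ (u : absoluteGaloisGroup K) w₀ - w₀) :=
    fun u => by
      have h := hw₀ u
      exact h
  -- (α): `Φ(Frq) = red e + (Frq w₀ − w₀) = (Frq − 1)(red t + w₀)`
  have hM : ∀ x : T.toTopRep, red.hom (I • x) = 0 := fun x => by rw [map_smul]; exact hI _
  have hFr : Φ.1 Frq = red.hom e + (T'.toTopRep.ρ Frq w₀ - w₀) :=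
    apply_eq_of_smul_witness T.toTopRep T'.toTopRep red U h0 Φ (fun u => Ψ.1 u) (fun u => z.1 u) w₀ hΦ
      hM Frq e hW
  refine ⟨red.hom t + w₀, ?_, fun u hu => ?_⟩
  · rw [hFr, he', map_sub, map_sub, hM, sub_zero, TopRep.hom_comm_apply, map_add]
    abel
  · rw [hΦ u, hIvan Ψ u hu, map_zero, zero_add, hIqT' _ hu, hIqT' _ hu, sub_self, sub_self]

end Main

end Transverse

end Derivative

end Summit.BirchSwinnertonDyer.Rank1Residual.GaloisImage

end
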